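import Summits.KontsevichZagierPeriods.KontsevichZagierPeriods.Theses.SymplecticScissors
import Summits.KontsevichZagierPeriods.KontsevichZagierPeriods.Theorems.PlanarSAZylev.Negative.Kit
import Summits.KontsevichZagierPeriods.KontsevichZagierPeriods.Theorems.SymplecticScissorsTransportToGroup
import Summits.KontsevichZagierPeriods.KontsevichZagierPeriods.Theorems.SymplecticScissorsGroupToAreas
import Summits.KontsevichZagierPeriods.KontsevichZagierPeriods.Theorems.SymplecticScissorsPlanarSAZylev
import Summits.KontsevichZagierPeriods.KontsevichZagierPeriods.Theorems.SymplecticScissorsPlanarCompiler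
import Summits.KontsevichZagierPeriods.KontsevichZagierPeriods.Theorems.SymplecticScissorsRealOnePeriodRelations
import Summits.KontsevichZagierPeriods.KontsevichZagierPeriods.Theorems.SymplecticScissorsCurvePeriodsTransferRecord

/-!
# `PlanarTransport` (stmt-KontsevichZagierPeriods-9849) — logical position of the Monge form

Route `SymplecticScissors`, support item `PlanarTransport` (the card's headline, "curved
Bolyai–Gerwien over ℚ̄": two planar `ℚ`-regions of equal finite area have full-measure
`ℚ`-semialgebraic restrictions related by ONE change-of-variables instance).

This file records, machine-checked, that the headline is *exactly* the conjunction of the two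
cruxes `PlanarK0Injective` (stmt-9847) and `PlanarSAZylev` (stmt-9848) once the provable-now
null-set bookkeeping `TransportToGroup` (stmt-9850) is available:

* `planarK0Injective_of_planarTransport` — `TransportToGroup → PlanarTransport → PlanarK0Injective`
  (the Monge map between full-measure restrictions is read back into the planar set-chain group);
* `planarTransport_iff_and` — `TransportToGroup → (PlanarTransport ↔ PlanarK0Injective ∧ PlanarSAZylev)`,
  the other two arrows being `planarSAZylev_of_planarTransport` (soundness of moves (1a), (2)) and
  `planarTransport_of` (composition) of `Theorems/PlanarSAZylev/Negative/Kit.lean`.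

So the item closes by `planarTransport_of PlanarK0Injective_holds PlanarSAZylev_holds` the moment
both cruxes land, and any refutation of it refutes one of them.
[Kontsevich–Zagier 2001, §1.2; Cresson–Viu-Sos 2022, Problem 2.1; Boltianskii 1978, §16 Thm 22 (Hadwiger: for a group of
motions containing all translations, equicomplementable ⟺ equidecomposable; Zylev's almost-transitive form, Thm 22′ ff.)]
[cite: KontsevichZagier2001, §1.2] [cite: CressonViusos2022, Problem 2.1] [cite: Boltianskii1978, §16 Thm 22]

REPAIR 2026-08-19 (cell pub-kz1p, seat b2b-kz1p-1; import + two identifiers, NO statement or proof changed): since the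
items-cap autofix of 2026-08-16T14:16Z dropped the route declarations `PeriodConjectureCurveType` (stmt-14055) and
`CurvePeriodsTransfer` (stmt-11129) from `Theses/SymplecticScissors.lean`, the constants this file names live only in the
record module `Theorems/SymplecticScissorsCurvePeriodsTransferRecord.lean` (same namespace, ledger signatures verbatim;
`PeriodConjectureCurveType` is `δ`-equal to `Literature.NumberTheory.Transcendental.HuberWustholzCurvePeriods`), now
imported; and the two uses of the deprecated alias `RealOnePeriodRelations_of_periodConjectureCurveType` are spelt by its
target `RealOnePeriodRelations.realOnePeriodRelations_of_huberWustholzCurvePeriods`.  Without this the source did not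
elaborate at HEAD (the build farm kept serving the module's pre-drop object file, so every newer module importing it —
`Theorems/KzOnePeriodsRungOneOfHW.lean`, `Theorems/KzOnePeriodsGaps.lean` — stayed unbuilt).
-/

noncomputable section

open Literature.NumberTheory.Transcendental
open Summit.KontsevichZagierPeriods.KontsevichZagierPeriods.Theses.SymplecticScissors

namespace Summit.KontsevichZagierPeriods.SymplecticScissors.PlanarTransport

open PlanarSAZylevNegative (planarSAZylev_of_planarTransport planarTransport_of)

/-- **Monge form ⟹ group form.** Given the null-set bookkeeping `TransportToGroup` (stmt-9850:
`[r] = [s] + [r ∖ s]` by rule (1a) and null planar sets vanish in the planar set-chain group), a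
single change-of-variables instance between full-measure integrand-`1` restrictions of two
equal-area planar `ℚ`-regions places `[r] − [r']` in the planar set-chain group. [folklore] -/
theorem planarK0Injective_of_planarTransport (hT : TransportToGroup) (h : PlanarTransport) :
    PlanarK0Injective := by
  intro r r' h1 h2 hv
  obtain ⟨s, s', hs, hsv, hs', hs'v, hs1, hs'1, hmem⟩ := h r r' h1 h2 hv
  exact hT r r' s s' h1 h2 hs1 hs'1 hs hsv hs' hs'v hmem

/-- **Logical position of the headline.** Modulo the provable-now support `TransportToGroup`
(stmt-9850), the Monge form `PlanarTransport` is equivalent to the conjunction of the two cruxes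
`PlanarK0Injective` (stmt-9847) and `PlanarSAZylev` (stmt-9848): `⇒` by
`planarK0Injective_of_planarTransport` and soundness (`planarSAZylev_of_planarTransport`), `⇐` by
composition (`planarTransport_of`). [folklore] -/
theorem planarTransport_iff_and (hT : TransportToGroup) :
    PlanarTransport ↔ PlanarK0Injective ∧ PlanarSAZylev :=
  ⟨fun h => ⟨planarK0Injective_of_planarTransport hT h, planarSAZylev_of_planarTransport h⟩,
    fun h => planarTransport_of h.1 h.2⟩

/-! ## Unconditional logical position (session 2026-08-16, stmt-9849)

With the null-set bookkeeping `TransportToGroup` now PROVED in the tree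
(`Theorems/SymplecticScissorsTransportToGroup.lean`, `TransportToGroup_proof`), the two conditional
statements above become unconditional: the headline `PlanarTransport` is *literally* the conjunction
of the two cruxes `PlanarK0Injective` (stmt-9847) and `PlanarSAZylev` (stmt-9848). -/

/-- **Monge form ⟹ group form, unconditionally.** A single change-of-variables instance between
full-measure integrand-`1` restrictions of two equal-area planar `ℚ`-regions places `[r] − [r']` in
the planar set-chain group; the bookkeeping hypothesis of `planarK0Injective_of_planarTransport` is
discharged by the tree's `TransportToGroup_proof`. [Kontsevich–Zagier 2001, §1.2] -/
theorem planarK0Injective_of_planarTransport_unconditional (h : PlanarTransport) :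
    PlanarK0Injective :=
  planarK0Injective_of_planarTransport
    Summit.KontsevichZagierPeriods.SymplecticScissors.TransportToGroup.TransportToGroup_proof h

/-- **The headline is exactly the conjunction of the two cruxes.**
`PlanarTransport ↔ PlanarK0Injective ∧ PlanarSAZylev`, with no hypothesis: `⇒` by the proved
null-set bookkeeping (`TransportToGroup_proof`) and soundness of moves (1a), (2)
(`planarSAZylev_of_planarTransport`); `⇐` by composition (`planarTransport_of`). So item stmt-9849
closes by `planarTransport_of PlanarK0Injective_holds PlanarSAZylev_holds` and by nothing weaker:
any proof of it proves both cruxes, any refutation of it refutes one of them.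
[Kontsevich–Zagier 2001, §1.2; Cresson–Viu-Sos 2022, Problem 2.1] -/
theorem planarTransport_iff_cruxes : PlanarTransport ↔ PlanarK0Injective ∧ PlanarSAZylev :=
  planarTransport_iff_and
    Summit.KontsevichZagierPeriods.SymplecticScissors.TransportToGroup.TransportToGroup_proof

/-- **The headline implies the sector statement.** `PlanarTransport → PlanarAreas` (stmt-4990, the
layer `N = 2` of the frame `VolumeForm`): Monge form ⟹ group form (proved bookkeeping
`TransportToGroup_proof`) ⟹ KZ-equivalence (proved `groupToAreas_proof`: the planar set-chain group
lies in `KZ.relations`). [Kontsevich–Zagier 2001, §1.2] -/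
theorem planarAreas_of_planarTransport (h : PlanarTransport) : PlanarAreas :=
  fun r r' h1 h2 hv =>
    groupToAreas_proof r r' (planarK0Injective_of_planarTransport_unconditional h r r' h1 h2 hv)

end Summit.KontsevichZagierPeriods.SymplecticScissors.PlanarTransport

/-! ## Closing recipes from the route's staffed items (session 2026-08-16, stmt-9849, seat 3)

The conjunction node `PlanarK0Injective` (stmt-9847) is itself `PlanarCompiler` (stmt-10058) applied to
`RealOnePeriodRelations` (stmt-10042), and the latter is `CurvePeriodsTransfer` (stmt-11129) applied to
`PeriodConjectureCurveType` (stmt-14055) — all by `rfl` on the route file's verbatim-inlined antecedents.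
The theorems below record every closing path of the headline through those items, so that the item
closes by a one-line application the moment its inputs land, and state precisely what it is
conditional on today. -/

namespace Summit.KontsevichZagierPeriods.SymplecticScissors.PlanarTransport

open PlanarSAZylevNegative (planarTransport_of)

/-- **Over planar Zylev the headline IS the group form.** Given the transcendence-free crux
`PlanarSAZylev` (stmt-9848), `PlanarTransport ↔ PlanarK0Injective` (stmt-9847): `⇒` is the proved
null-set bookkeeping (`planarK0Injective_of_planarTransport_unconditional`), `⇐` is composition
(`planarTransport_of`). [Kontsevich–Zagier 2001, §1.2; Boltianskii 1978, Thm 22] -/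
theorem planarTransport_iff_planarK0Injective (hZ : PlanarSAZylev) :
    PlanarTransport ↔ PlanarK0Injective :=
  ⟨planarK0Injective_of_planarTransport_unconditional, fun hK => planarTransport_of hK hZ⟩

/-- **The headline from the route's three staffed cruxes.** `RealOnePeriodRelations` (stmt-10042,
the input crux), `PlanarCompiler` (stmt-10058, whose antecedent is `RealOnePeriodRelations` verbatim,
so `hC hR : PlanarK0Injective` by `rfl`) and `PlanarSAZylev` (stmt-9848) give `PlanarTransport`.
[Kontsevich–Zagier 2001, §1.2; Huber–Wüstholz 2022, Thm 13.3 (2)] -/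
theorem planarTransport_of_chain (hR : RealOnePeriodRelations) (hC : PlanarCompiler)
    (hZ : PlanarSAZylev) : PlanarTransport :=
  planarTransport_of (hC hR) hZ

/-- **The headline from the apex statement.** `PeriodConjectureCurveType` (stmt-14055, the body of
the cited fact `HuberWustholzCurvePeriods`, Huber–Wüstholz 2022 Thm 13.3 (2)) and
`CurvePeriodsTransfer` (stmt-11129, literally `PeriodConjectureCurveType → RealOnePeriodRelations`)
feed `planarTransport_of_chain`. [Huber–Wüstholz 2022, Thm 13.3 (2); Kontsevich–Zagier 2001, §1.2] -/
theorem planarTransport_of_apex (hP : PeriodConjectureCurveType) (hT : CurvePeriodsTransfer)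
    (hC : PlanarCompiler) (hZ : PlanarSAZylev) : PlanarTransport :=
  planarTransport_of_chain (hT hP) hC hZ

/-- **The headline modulo the cited theorem.** CONDITIONAL on the tree's cite-only named fact
`Literature.NumberTheory.Transcendental.HuberWustholzCurvePeriods` (Huber–Wüstholz 2022,
Thm 13.3 (2), p. 121 — Kontsevich's period conjecture for periods of curve type), whose body is
`PeriodConjectureCurveType` (`Iff.rfl`), the headline follows from the three provable-grade route
items `CurvePeriodsTransfer` (stmt-11129), `PlanarCompiler` (stmt-10058), `PlanarSAZylev` (stmt-9848):
this is the exact trust base of any proof of stmt-9849 along this route.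
[Huber–Wüstholz 2022, Thm 13.3 (2)] -/
theorem planarTransport_of_huberWustholz (hHW : HuberWustholzCurvePeriods)
    (hT : CurvePeriodsTransfer) (hC : PlanarCompiler) (hZ : PlanarSAZylev) : PlanarTransport :=
  planarTransport_of_apex hHW hT hC hZ

end Summit.KontsevichZagierPeriods.SymplecticScissors.PlanarTransport

/-! ## The headline after the two 2026-08-16 landings (session c1, stmt-9849)

Two of the three inputs of the recipes above are now PROVED in the tree:
`PlanarSAZylev` (stmt-9848) by `PlanarSAZylev.PlanarSAZylev_of` (line reservoir-peeling,
`Theorems/SymplecticScissorsPlanarSAZylev.lean`) and `PlanarCompiler` (stmt-10058) by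
`PlanarCompilerProof.PlanarCompiler_proof` (line twist-restoring-shear,
`Theorems/SymplecticScissorsPlanarCompiler.lean`). Discharging them leaves the headline with exactly
ONE open input on each closing path:

* `planarTransport_iff_planarK0Injective_unconditional` — `PlanarTransport ↔ PlanarK0Injective`
  (stmt-9847) with no hypothesis: the Monge form IS the group form;
* `planarTransport_of_realOnePeriodRelations` — `RealOnePeriodRelations → PlanarTransport`
  (stmt-10042, the route's input crux, first binder of `closes`);
* `planarTransport_of_periodConjectureCurveType` / `planarTransport_of_huberWustholz_transfer` — the
  apex (stmt-14055, body of the cite-only fact `HuberWustholzCurvePeriods`) plus the transfer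
  `CurvePeriodsTransfer` (stmt-11129).

Closing recipe of stmt-9849 (one line, append-only here) the moment stmt-9847 closes `proved` by a
theorem `T : PlanarK0Injective`: `theorem planarTransport_proof : PlanarTransport :=
planarTransport_of_planarK0Injective T`; if instead stmt-10042 closes by `T' : RealOnePeriodRelations`:
`planarTransport_of_realOnePeriodRelations T'`. Refuting recipe if stmt-9847 is refuted by
`N : ¬ PlanarK0Injective`: `fun h => N (planarTransport_iff_planarK0Injective_unconditional.mp h)`. -/

namespace Summit.KontsevichZagierPeriods.SymplecticScissors.PlanarTransport

open PlanarSAZylevNegative (planarTransport_of)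

/-- **Group form ⟹ Monge form, unconditionally.** `PlanarK0Injective → PlanarTransport`: compose a
planar set-chain between two equal-area integrand-`1` regions (the hypothesis) with the PROVED planar
semialgebraic Zylev theorem `PlanarSAZylev_of` (chain-equivalent planar `ℚ`-regions are
equidecomposable modulo null sets by ONE change-of-variables instance).
[Boltianskii 1978, §16 Thm 22; Kontsevich–Zagier 2001, §1.2] -/
theorem planarTransport_of_planarK0Injective (hK : PlanarK0Injective) : PlanarTransport :=
  planarTransport_of hK PlanarSAZylev.PlanarSAZylev_of

/-- **The Monge form IS the group form.** `PlanarTransport ↔ PlanarK0Injective` with no hypothesis: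
`⇒` is the proved null-set bookkeeping (`planarK0Injective_of_planarTransport_unconditional`, via
`TransportToGroup_proof`), `⇐` is `planarTransport_of_planarK0Injective` (via the proved
`PlanarSAZylev_of`). Hence item stmt-9849 and crux stmt-9847 are the same statement: either closes or
refutes the other by one application. [Kontsevich–Zagier 2001, §1.2; Boltianskii 1978, §16 Thm 22] -/
theorem planarTransport_iff_planarK0Injective_unconditional : PlanarTransport ↔ PlanarK0Injective :=
  ⟨planarK0Injective_of_planarTransport_unconditional, planarTransport_of_planarK0Injective⟩

/-- **The headline from the input crux alone.** `RealOnePeriodRelations → PlanarTransport`: the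
PROVED compiler `PlanarCompiler_proof` (stmt-10058; its antecedent is `RealOnePeriodRelations`
verbatim, so `PlanarCompiler_proof hR : PlanarK0Injective`) followed by
`planarTransport_of_planarK0Injective`. This is the headline's position in the cone of `closes`:
it follows from the route's first binder and nothing else. [Kontsevich–Zagier 2001, §1.2] -/
theorem planarTransport_of_realOnePeriodRelations (hR : RealOnePeriodRelations) : PlanarTransport :=
  planarTransport_of_planarK0Injective (PlanarCompilerProof.PlanarCompiler_proof hR)

/-- **The headline from the apex and the transfer.** `PeriodConjectureCurveType` (stmt-14055, Huber–
Wüstholz 2022 Thm 13.3 (2) in the tree's elementary rendering) and `CurvePeriodsTransfer`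
(stmt-11129, literally `PeriodConjectureCurveType → RealOnePeriodRelations`) give the headline through
`planarTransport_of_realOnePeriodRelations`; both remaining inputs are open items of the route with
their own lines. [Huber–Wüstholz 2022, Thm 13.3 (2); Kontsevich–Zagier 2001, §1.2] -/
theorem planarTransport_of_periodConjectureCurveType (hP : PeriodConjectureCurveType)
    (hT : CurvePeriodsTransfer) : PlanarTransport :=
  planarTransport_of_realOnePeriodRelations (hT hP)

/-- **The headline modulo the cited theorem and ONE provable-grade item.** CONDITIONAL on the tree's
cite-only named fact `Literature.NumberTheory.Transcendental.HuberWustholzCurvePeriods`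
(Huber–Wüstholz 2022, Thm 13.3 (2), p. 121), whose body is `PeriodConjectureCurveType` verbatim, the
headline follows from the single open route item `CurvePeriodsTransfer` (stmt-11129): the exact trust
base of stmt-9849 along this route after the landings of `PlanarSAZylev_of` and `PlanarCompiler_proof`.
[Huber–Wüstholz 2022, Thm 13.3 (2)] -/
theorem planarTransport_of_huberWustholz_transfer (hHW : HuberWustholzCurvePeriods)
    (hT : CurvePeriodsTransfer) : PlanarTransport :=
  planarTransport_of_periodConjectureCurveType hHW hT

end Summit.KontsevichZagierPeriods.SymplecticScissors.PlanarTransport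

/-! ## The headline modulo the apex alone (session c3, stmt-9849, 2026-08-16)

Since the previous section was written, the transfer has been discharged in the tree:
`RealOnePeriodRelations.RealOnePeriodRelations_of_periodConjectureCurveType :
PeriodConjectureCurveType → RealOnePeriodRelations` (line `nash-retraction-thin-strip`,
`Theorems/SymplecticScissorsRealOnePeriodRelations.lean`: every stub of that line is a landed theorem
except the apex). Composing it with `planarTransport_of_realOnePeriodRelations` leaves the headline with
exactly ONE open input on its closing path — the apex `PeriodConjectureCurveType` (stmt-14055), whose body
is verbatim the cite-only named fact `Literature.NumberTheory.Transcendental.HuberWustholzCurvePeriods`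
(Huber–Wüstholz 2022, Thm 13.3 (2): Kontsevich's period conjecture for periods of curve type):

* `planarK0Injective_of_periodConjectureCurveType`, `planarTransport_of_periodConjectureCurveType_alone`
  — the group form (stmt-9847) and the Monge form (stmt-9849) from the apex item alone;
* `planarTransport_of_huberWustholzCurvePeriods` — **the headline CONDITIONAL on the cited theorem and
  on nothing else**: curved Bolyai–Gerwien over `ℚ̄` (two planar `ℚ`-regions of equal finite area have
  full-measure `ℚ`-semialgebraic restrictions related by ONE piecewise-Nash area-preserving bijection)
  modulo Huber–Wüstholz; its trust base is the kernel axioms and the hypothesis;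
* `planarK0Injective_of_huberWustholzCurvePeriods`, `planarAreas_of_huberWustholzCurvePeriods` — the
  same for the group form and for the layer `N = 2` of the frame (stmt-4990).

Closing recipe of stmt-9849 the moment stmt-14055 closes `proved` by a theorem
`T : PeriodConjectureCurveType` (one line, append-only here):
`theorem planarTransport_proof : PlanarTransport := planarTransport_of_periodConjectureCurveType_alone T`. -/

namespace Summit.KontsevichZagierPeriods.SymplecticScissors.PlanarTransport

/-- **Group form from the apex alone.** `PeriodConjectureCurveType → PlanarK0Injective` (stmt-14055 ⟹
stmt-9847): the landed transfer `RealOnePeriodRelations_of_periodConjectureCurveType` (Huber–Wüstholz in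
real clothes, conditional on the apex) followed by the PROVED compiler `PlanarCompiler_proof` (whose
antecedent is `RealOnePeriodRelations` verbatim). [Huber–Wüstholz 2022, Thm 13.3 (2);
Kontsevich–Zagier 2001, §1.2] -/
theorem planarK0Injective_of_periodConjectureCurveType (hP : PeriodConjectureCurveType) :
    PlanarK0Injective :=
  PlanarCompilerProof.PlanarCompiler_proof
    (Summit.KontsevichZagierPeriods.SymplecticScissors.RealOnePeriodRelations.realOnePeriodRelations_of_huberWustholzCurvePeriods
      hP)

/-- **Monge form from the apex alone.** `PeriodConjectureCurveType → PlanarTransport` (stmt-14055 ⟹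
stmt-9849): the landed transfer `RealOnePeriodRelations_of_periodConjectureCurveType` followed by
`planarTransport_of_realOnePeriodRelations` (proved compiler, proved planar semialgebraic Zylev). This is
the item's exact position today: it closes by one application the moment the apex closes, and by nothing
short of the crux `PlanarK0Injective` (`planarTransport_iff_planarK0Injective_unconditional`).
[Huber–Wüstholz 2022, Thm 13.3 (2); Kontsevich–Zagier 2001, §1.2] -/
theorem planarTransport_of_periodConjectureCurveType_alone (hP : PeriodConjectureCurveType) :
    PlanarTransport :=
  planarTransport_of_realOnePeriodRelations
    (Summit.KontsevichZagierPeriods.SymplecticScissors.RealOnePeriodRelations.realOnePeriodRelations_of_huberWustholzCurvePeriods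
      hP)

/-- **Curved Bolyai–Gerwien over `ℚ̄` modulo Huber–Wüstholz.** CONDITIONAL on the tree's cite-only
named fact `Literature.NumberTheory.Transcendental.HuberWustholzCurvePeriods` (Huber–Wüstholz 2022,
Thm 13.3 (2), p. 121: every `ℚ̄`-linear relation among periods of curve type is a `ℚ̄`-combination of
the elementary relations R1–R5), whose body is `PeriodConjectureCurveType` verbatim: any two planar
`ℚ`-semialgebraic sets of equal finite area have full-measure `ℚ`-semialgebraic subsets that are source
and target of ONE change-of-variables move with integrand `1` (a `ℚ`-semialgebraic bijection,
differentiable within its source, `|det| = 1`). Every other input — the real-clothes transfer, the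
planar compiler, planar semialgebraic Zylev, the null-set bookkeeping — is a theorem of the tree, so the
cited theorem is the whole trust base of the route's headline beyond the kernel axioms.
[Huber–Wüstholz 2022, Thm 13.3 (2); Kontsevich–Zagier 2001, §1.2; Cresson–Viu-Sos 2022, Problem 2.1] -/
theorem planarTransport_of_huberWustholzCurvePeriods (hHW : HuberWustholzCurvePeriods) :
    PlanarTransport :=
  planarTransport_of_periodConjectureCurveType_alone hHW

/-- **Planar `K₀`-injectivity modulo Huber–Wüstholz.** CONDITIONAL on the cite-only named fact
`HuberWustholzCurvePeriods` alone: area is the only invariant of planar `ℚ`-regions under curved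
scissors (rule 1a) and `ℚ`-semialgebraic area-preserving injections (rule 2) among planar sets
(crux stmt-9847). [Huber–Wüstholz 2022, Thm 13.3 (2); Kontsevich–Zagier 2001, §1.2] -/
theorem planarK0Injective_of_huberWustholzCurvePeriods (hHW : HuberWustholzCurvePeriods) :
    PlanarK0Injective :=
  planarK0Injective_of_periodConjectureCurveType hHW

/-- **The planar layer of the frame modulo Huber–Wüstholz.** CONDITIONAL on the cite-only named fact
`HuberWustholzCurvePeriods` alone: two integrand-`1` representations of dimension `2` with equal value
are KZ-equivalent (`PlanarAreas`, stmt-4990, the case `N = 2` of `VolumeForm`), through the Monge form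
and `planarAreas_of_planarTransport`. [Huber–Wüstholz 2022, Thm 13.3 (2); Kontsevich–Zagier 2001, §1.2] -/
theorem planarAreas_of_huberWustholzCurvePeriods (hHW : HuberWustholzCurvePeriods) : PlanarAreas :=
  planarAreas_of_planarTransport (planarTransport_of_huberWustholzCurvePeriods hHW)

end Summit.KontsevichZagierPeriods.SymplecticScissors.PlanarTransport
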